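import Literature.MathematicalPhysics.QuantumLattice.MarkovZeroEntropyCellUBox
import Literature.MathematicalPhysics.QuantumLattice.TypeClassSidecarReaderTTPrimeColdRow
import HarnessLib

/-!
# The Markov + zero-entropy cell on a `U`-BOX, GENUINE `t–t'` edition: a `t–t'` corner certificate AT `(β_h, μ, s₀, U₀)`
# transported along `t'` from `s₀` to `s` (price `β_h |s − s₀| 16/π²`), moved UP in `U` for free / DOWN at the kinematic docc
# price, the `T = 0` row at the TARGET `(s, U, n)` as cold input

Family `hubbard` (topic `MathematicalPhysics/QuantumLattice`), seat hubbard-downfold-unc-1 (the `U` direction of «a parameter BOX maps to a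
certified word»). Sequel of `MarkovZeroEntropyCellUBox` (§3 there: the `t' = 0` certificate transported from `0` to `t'`) and of
hubbard-thermal-p2's `TypeClassSidecarReaderTTPrimeColdRow` (the genuine `t–t'` certificate AT the point, no transport, no `U`-move): once
GENUINE `t–t'` Markov certificates exist at a box corner `(s₀, U₀)` (hubbard-thermal-p2's kit j282018 / j283516 at `(−1/4, 8)`, j282025 /
j283521 at `(−1/4, 17/2)`), the cold rays of a `(t', U, n)`-cell around it pay only `β_h |s − s₀| 16/π²` (`|s − s₀| ≤ 1/20` on the cuprate
box instead of `|s| ≤ 3/10` for the transported `t' = 0` anchor):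

* `IsTorusLimitOfMixture.meanEnergy_hubbardTTPrime_le_of_rectMarkovCertificateTT'_tPrimeTransport_left_U_of_energyDensityTT'_le` —
  rectangle `t–t'` C1 at `(β_h, μ, s₀, U₁)`, `U₁ ≤ U`, `T = 0` row `e(t, s, U, n) ≤ e⁺`: for every torus limit at `(β, t, s, U, n)`
  (`U ≥ 0`, `0 ≤ n < 2`, `0 < β_h < β`), `e_Φ(ω) ≤ ((c − β_h μ n) + β_h |s − s₀| 16/π² + β e⁺)/(β − β_h)`;
* `…_rectMarkovCertificateTT'_tPrimeTransport_anchorU_kinematic_of_energyDensityTT'_le` — the same from ONE anchor `U₀` on either side,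
  `+ β_h·max(U₀ − U, 0)·n/2` in the numerator.

Everything is PROVED; no definition, no named fact, no number. HONEST SCOPE: the cold input is the zero-entropy bound, so the cell is only as
good as the `T = 0` cap at the target; nothing moves in `β` here (use `markovChordBound_anti` downstream). WHAT THIS IS NOT: no certificate,
no phase sentence.

## Mathlib / tree search

REUSED: `eventually_log_partitionFn_sectorHamiltonianTT'_le_of_clusterCertificateTT'` with the rectangle bookkeeping exactly as in
`TypeClassSidecarReaderTTPrimeColdRow` (hubbard-thermal-p2); `eventually_log_partitionFn_sector_le_of_tPrime_anchor_ceiling`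
(`TypeClassSidecarReaderTPrimeTransport`, general `s₀ → s`); `…le_of_hot_left_U_of_energyDensityTT'_le` /
`…le_of_hot_anchorU_kinematic_of_energyDensityTT'_le` (`MarkovZeroEntropyCellUBox` §1).
`rg "rectMarkovCertificateTT'_tPrimeTransport" Literature/MathematicalPhysics/QuantumLattice` (2026-08-27): nothing.

## References

* D. Poulin, M. B. Hastings, Phys. Rev. Lett. 106 (2011) 080403, eqs. (3)–(8). [cite: PoulinHastings2011, eqs. (3)–(8)]
* S. J. Gustafson, I. M. Sigal, *Mathematical Concepts of Quantum Mechanics*, §18.3 Theorem 18.10. [cite: GustafsonSigal2003, §18.3 Theorem 18.10]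
* R. B. Israel, *Convexity in the Theory of Lattice Gases* (1979), Thm. I.3.4, Lemma II.3.1. [cite: Israel1979, Thm. I.3.4] [cite: Israel1979, Lemma II.3.1]
* E. H. Lieb, Commun. Math. Phys. 31 (1973) 327, §V (5.2)–(5.4). [cite: Lieb1973, §V (5.2)–(5.4)]
-/

noncomputable section

namespace Literature.MathematicalPhysics.QuantumLattice

open Matrix Finset HubbardWave0 ThermodynamicLimit LiebThm1 AndersonCluster Literature.Probability.LatticeModels
open _root_.Filter
open scoped _root_.Topology ComplexOrder BigOperators

namespace InfVolFermionState

variable {t s U n β : ℝ} {ω : InfVolFermionState 2} {Ls : ℕ → ℕ}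

/-- **The hot input of a GENUINE `t–t'` rectangle certificate, transported along `t'`.** Rectangle C1 data (`rectWindow a' b'`,
`a', b' ≥ 2`) at `(β_h, μ)` for the `t–t'` model AT `(t, s₀, U₁)` (`cornerEnergyRepTT'`, constant `c`), `β_h > 0`, `0 ≤ n < 2`: for every
`ε > 0`, eventually along `Ls → ∞`, `log Re Z_{β_h}(H_{Ls j}(t, s, U₁)|_n) ≤ ((c − β_h μ n) + β_h |s − s₀| 16/π² + ε)(Ls j)²`.
[cite: PoulinHastings2011, eqs. (3)–(8)] [cite: Lieb1973, §V (5.2)–(5.4)] -/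
theorem eventually_log_partitionFn_sector_le_of_rectMarkovCertificateTT'_tPrimeTransport
    (hn0 : 0 ≤ n) (hn2 : n < 2) (t s : ℝ) (U₁ : ℝ) {βh : ℝ} (hβh : 0 < βh) (hLs : Tendsto Ls atTop atTop)
    (s₀ μ : ℝ) {a' b' : ℕ} (ha' : 2 ≤ a') (hb' : 2 ≤ b')
    {ι : Type*} (sι : Finset ι) (Sw : ι → Finset (Site 2)) (hS : ∀ i, Sw i ⊆ rectWindow a' b') (zw : ι → Site 2)
    (hzw : ∀ i, shiftSet (zw i) (Sw i) ⊆ rectWindow a' b') {O : ∀ i, FermionOp (Sw i)}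
    (hO : ∀ i ∈ sι, (O i).IsHermitian) (g : ι → ℝ)
    {LB : FermionOp ((rectWindow a' b').erase (mkSite2 (a' - 1) (b' - 1)))} (hLB : LB.IsHermitian) {c : ℝ}
    (hcert : ((Real.exp c : ℂ) • cfc Real.exp LB -
      fermionPartialTrace (PolySite.incl (Finset.erase_subset (mkSite2 (a' - 1) (b' - 1)) (rectWindow a' b')))
        (cfc Real.exp (-((βh : ℂ) • (cornerEnergyRepTT' (rectWindow a' b') (mkSite2 (a' - 1) (b' - 1)) t s₀ U₁ μ +
            windowAnnihilator sι (rectWindow a' b') Sw hS zw hzw O g)) +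
          fermionEmbed (PolySite.incl (Finset.erase_subset (mkSite2 (a' - 1) (b' - 1)) (rectWindow a' b'))) LB))).PosSemidef) :
    ∀ ε : ℝ, 0 < ε → ∀ᶠ j in atTop,
      Real.log (partitionFn βh (sectorHamiltonianTT' t s U₁ n (Ls j))).re ≤
        (((c - βh * μ * n) + βh * |s - s₀| * (16 / Real.pi ^ 2)) + ε) * (Ls j : ℝ) ^ 2 := by
  have hAc := rectCorner_mem_rectWindow (a := a') (b := b') (by omega) (by omega)
  -- hot input AT `(βh, t, s₀, U₁)` from the `t–t'` certificate (as in `TypeClassSidecarReaderTTPrimeColdRow`)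
  have hu : ∀ ε : ℝ, 0 < ε → ∀ᶠ j in atTop,
      Real.log (partitionFn βh (sectorHamiltonianTT' t s₀ U₁ n (Ls j))).re ≤ ((c - βh * μ * n) + ε) * (Ls j : ℝ) ^ 2 :=
    fun ε hε => eventually_log_partitionFn_sectorHamiltonianTT'_le_of_clusterCertificateTT' t s₀ U₁ μ βh hn0 hn2.le hLs
      hAc toLex_le_toLex_rectCorner (rectWindow_subset_halfOpenBox_max a' b')
      (fun i => bondWeightSum_cornerBondWeight hAc (rectCorner_sub_unitVec_mem_rectWindow ha' hb' i))
      (diagBondWeightSum_cornerDiagBondWeight hAc (rectCorner_sub_unitVec_mem_rectWindow ha' hb' 0)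
        (rectCorner_sub_unitVec_mem_rectWindow ha' hb' 1) (rectCorner_sub_unitVec_sub_unitVec_mem_rectWindow ha' hb'))
      (siteWeightSum_cornerSiteWeight hAc) (siteWeightSum_mul_cornerSiteWeight hAc (-μ))
      (isHermitian_windowAnnihilator sι _ Sw hS zw hzw hO g)
      (fun L _ hL3 hℓL => trace_window_mul_windowAnnihilator
        (relabel_translate_gibbsDensity L (relabel_translate_hubbardTorusTT'_sub_mu (L := L) t s₀ U₁ μ) βh)
        _ sι Sw hS zw hzw O g) hLB hcert hε
  -- transport along `t'` from `s₀` to `s`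
  exact eventually_log_partitionFn_sector_le_of_tPrime_anchor_ceiling hn0 hn2 t U₁ hβh s₀ s hLs hu

/-- **GENUINE `t–t'` rectangle C1 at `(β_h, μ, s₀, U₁)`, transported to `s`, `U₁ ≤ U` (free), `T = 0` row at the target**: for every
torus limit of the canonical sector Gibbs states at `(β, t, s, U, n)` (`U ≥ 0`, `0 ≤ n < 2`, `0 < β_h < β`) and every `T = 0` row
`e(t, s, U, n) ≤ e⁺`: `e_Φ(ω) ≤ ((c − β_h μ n) + β_h |s − s₀| 16/π² + β e⁺)/(β − β_h)`.
[cite: PoulinHastings2011, eqs. (3)–(8)] [cite: Lieb1973, §V (5.2)–(5.4)] [cite: Israel1979, Thm. I.3.4] [cite: GustafsonSigal2003, §18.3 Theorem 18.10] -/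
theorem IsTorusLimitOfMixture.meanEnergy_hubbardTTPrime_le_of_rectMarkovCertificateTT'_tPrimeTransport_left_U_of_energyDensityTT'_le
    (hU0 : 0 ≤ U) (hn0 : 0 ≤ n) (hn2 : n < 2) {U₁ : ℝ} (hU1 : U₁ ≤ U)
    (h : ω.IsTorusLimitOfMixture (sectorGibbsCount n) (fun L => sectorGibbsWeightTT' β t s U n L)
      (fun L => sectorGibbsVectorTT' t s U n L) Ls)
    (hLs : Tendsto Ls atTop atTop) {βh : ℝ} (hβh : 0 < βh) (hlt : βh < β)
    (s₀ μ : ℝ) {a' b' : ℕ} (ha' : 2 ≤ a') (hb' : 2 ≤ b')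
    {ι : Type*} (sι : Finset ι) (Sw : ι → Finset (Site 2)) (hS : ∀ i, Sw i ⊆ rectWindow a' b') (zw : ι → Site 2)
    (hzw : ∀ i, shiftSet (zw i) (Sw i) ⊆ rectWindow a' b') {O : ∀ i, FermionOp (Sw i)}
    (hO : ∀ i ∈ sι, (O i).IsHermitian) (g : ι → ℝ)
    {LB : FermionOp ((rectWindow a' b').erase (mkSite2 (a' - 1) (b' - 1)))} (hLB : LB.IsHermitian) {c : ℝ}
    (hcert : ((Real.exp c : ℂ) • cfc Real.exp LB -
      fermionPartialTrace (PolySite.incl (Finset.erase_subset (mkSite2 (a' - 1) (b' - 1)) (rectWindow a' b')))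
        (cfc Real.exp (-((βh : ℂ) • (cornerEnergyRepTT' (rectWindow a' b') (mkSite2 (a' - 1) (b' - 1)) t s₀ U₁ μ +
            windowAnnihilator sι (rectWindow a' b') Sw hS zw hzw O g)) +
          fermionEmbed (PolySite.incl (Finset.erase_subset (mkSite2 (a' - 1) (b' - 1)) (rectWindow a' b'))) LB))).PosSemidef)
    {eup : ℝ} (he : energyDensityTT' t s U n ≤ eup) :
    ω.meanEnergy (hubbardTTPrimeFermionInteraction t s U) 1 ≤
      (((c - βh * μ * n) + βh * |s - s₀| * (16 / Real.pi ^ 2)) + β * eup) / (β - βh) :=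
  h.meanEnergy_hubbardTTPrime_le_of_hot_left_U_of_energyDensityTT'_le hU0 hn0 hn2 hU1 hLs hβh hlt
    (eventually_log_partitionFn_sector_le_of_rectMarkovCertificateTT'_tPrimeTransport hn0 hn2 t s U₁ hβh hLs s₀ μ ha' hb'
      sι Sw hS zw hzw hO g hLB hcert) he

/-- **GENUINE `t–t'` rectangle C1 at ONE anchor `(β_h, μ, s₀, U₀)`, transported to `s`, kinematic price below the anchor**: for every
torus limit at `(β, t, s, U, n)` (`U ≥ 0`, `0 ≤ n < 2`, `0 < β_h < β`) and every `T = 0` row `e(t, s, U, n) ≤ e⁺`: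
`e_Φ(ω) ≤ ((c − β_h μ n) + β_h |s − s₀| 16/π² + β_h·max(U₀ − U, 0)·n/2 + β e⁺)/(β − β_h)` (above `U₀` the ceiling is free, below it
pays the kinematic docc price). [cite: PoulinHastings2011, eqs. (3)–(8)] [cite: Lieb1973, §V (5.2)–(5.4)] [cite: GustafsonSigal2003, §18.3 Theorem 18.10] -/
theorem IsTorusLimitOfMixture.meanEnergy_hubbardTTPrime_le_of_rectMarkovCertificateTT'_tPrimeTransport_anchorU_kinematic_of_energyDensityTT'_le
    (hU0 : 0 ≤ U) (hn0 : 0 ≤ n) (hn2 : n < 2) (U₀ : ℝ)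
    (h : ω.IsTorusLimitOfMixture (sectorGibbsCount n) (fun L => sectorGibbsWeightTT' β t s U n L)
      (fun L => sectorGibbsVectorTT' t s U n L) Ls)
    (hLs : Tendsto Ls atTop atTop) {βh : ℝ} (hβh : 0 < βh) (hlt : βh < β)
    (s₀ μ : ℝ) {a' b' : ℕ} (ha' : 2 ≤ a') (hb' : 2 ≤ b')
    {ι : Type*} (sι : Finset ι) (Sw : ι → Finset (Site 2)) (hS : ∀ i, Sw i ⊆ rectWindow a' b') (zw : ι → Site 2)
    (hzw : ∀ i, shiftSet (zw i) (Sw i) ⊆ rectWindow a' b') {O : ∀ i, FermionOp (Sw i)}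
    (hO : ∀ i ∈ sι, (O i).IsHermitian) (g : ι → ℝ)
    {LB : FermionOp ((rectWindow a' b').erase (mkSite2 (a' - 1) (b' - 1)))} (hLB : LB.IsHermitian) {c : ℝ}
    (hcert : ((Real.exp c : ℂ) • cfc Real.exp LB -
      fermionPartialTrace (PolySite.incl (Finset.erase_subset (mkSite2 (a' - 1) (b' - 1)) (rectWindow a' b')))
        (cfc Real.exp (-((βh : ℂ) • (cornerEnergyRepTT' (rectWindow a' b') (mkSite2 (a' - 1) (b' - 1)) t s₀ U₀ μ +
            windowAnnihilator sι (rectWindow a' b') Sw hS zw hzw O g)) +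
          fermionEmbed (PolySite.incl (Finset.erase_subset (mkSite2 (a' - 1) (b' - 1)) (rectWindow a' b'))) LB))).PosSemidef)
    {eup : ℝ} (he : energyDensityTT' t s U n ≤ eup) :
    ω.meanEnergy (hubbardTTPrimeFermionInteraction t s U) 1 ≤
      (((c - βh * μ * n) + βh * |s - s₀| * (16 / Real.pi ^ 2)) + βh * max (U₀ - U) 0 * (n / 2) + β * eup) / (β - βh) :=
  h.meanEnergy_hubbardTTPrime_le_of_hot_anchorU_kinematic_of_energyDensityTT'_le hU0 hn0 hn2 U₀ hLs hβh hlt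
    (eventually_log_partitionFn_sector_le_of_rectMarkovCertificateTT'_tPrimeTransport hn0 hn2 t s U₀ hβh hLs s₀ μ ha' hb'
      sι Sw hS zw hzw hO g hLB hcert) he

end InfVolFermionState

end Literature.MathematicalPhysics.QuantumLattice

end
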